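import Literature.Geometry.Riemannian.GromovW1Complete
import HarnessLib

/-!
# A `d_{GW₁}`-convergent sequence embeds into one Polish space with `W₁`-convergent push-forwards
# (Bamler 2023, §2.5, proof of the Lemma that `𝕄_r(V, b)` is closed)

R. Bamler, *Compactness theory of the space of super Ricci flows*, Invent. Math. 233 (2023), §2.5,
proof of the Lemma (`𝕄_r(V, b)` is closed in `(𝕄, d_{GW₁})`): *"suppose that
`(Xᵢ, dᵢ, μᵢ) → (X_∞, d_∞, μ_∞)` in `GW₁` … As in the proof of Theorem 2.17, we may pass to a
subsequence and find isometric embeddings `φᵢ : Xᵢ → Z`, `i = 1, 2, …, ∞`, into a complete and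
separable metric space `(Z, d_Z)` such that `(φᵢ)_* μᵢ → (φ_∞)_* μ_∞` in `W₁`. This reduces the lemma
to the following lemma [on `W₁`-limits]."* We construct `Z` (without passing to a subsequence):
embeddings `Xᵢ, X_∞ → Zᵢ` almost realising `d_{GW₁}(Xᵢ, X_∞)` are glued along the copies of `X_∞`
(`exists_isometry_seq_comm` of `GromovW1Complete.lean` with the constant interface `X_∞`), and `Z`
is the closure of all images in the completion.

* `exists_embeddings_wassersteinW1_le_add` — embeddings with
  `d^Z_{W₁} ≤ d_{GW₁}(μ, ν) + δ` (also when `d_{GW₁} = ∞`);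
* `exists_common_polish_of_tendsto_gromovW1` — **the common Polish space**.

Everything is proved; no definitions, no named facts.

## References

* R. H. Bamler, *Compactness theory of the space of super Ricci flows*, Invent. Math. 233 (2023),
  §2.5, proof of the Lemma (𝕄_r(V, b) is closed); §2.4, Lemma (combining isometric embeddings).
  [Bamler2023]
-/

noncomputable section

open Set MeasureTheory Filter Topology Metric Function TopologicalSpace
open scoped ENNReal NNReal

namespace Literature.Geometry.Riemannian

universe u

/-- Embeddings almost realising `d_{GW₁}`: for `δ > 0` there are a metric space `Z` and isometric
embeddings `φ, ψ` with `d^Z_{W₁}(φ_* μ, ψ_* ν) ≤ d_{GW₁}(μ, ν) + δ` (if `d_{GW₁} = ∞`, the disjoint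
union will do). [cite: Bamler2023, §2.4, Definition (Gromov–W₁ distance)] -/
theorem exists_embeddings_wassersteinW1_le_add {X Y : Type u} [MetricSpace X] [MeasurableSpace X]
    [MetricSpace Y] [MeasurableSpace Y] (μ : Measure X) (ν : Measure Y) {δ : ℝ≥0∞} (hδ : 0 < δ) :
    ∃ (Z : Type u) (_ : MetricSpace Z) (φ : X → Z) (ψ : Y → Z), Isometry φ ∧ Isometry ψ ∧
      @wassersteinW1 Z _ (borel Z) (@Measure.map X Z _ (borel Z) φ μ)
        (@Measure.map Y Z _ (borel Z) ψ ν) ≤ gromovW1 μ ν + δ := by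
  rcases eq_or_ne (gromovW1 μ ν) ∞ with htop | htop
  · letI : MetricSpace (X ⊕ Y) := Metric.metricSpaceSum
    refine ⟨X ⊕ Y, inferInstance, Sum.inl, Sum.inr, Metric.isometry_inl, Metric.isometry_inr, ?_⟩
    rw [htop, top_add]
    exact le_top
  · obtain ⟨Z, inst, φ, ψ, hφ, hψ, h⟩ :=
      exists_lt_of_gromovW1_lt (ENNReal.lt_add_right htop hδ.ne')
    exact ⟨Z, inst, φ, ψ, hφ, hψ, h.le⟩

/-- **A `d_{GW₁}`-convergent sequence and its limit embed isometrically into one complete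
separable metric space with `W₁`-convergent push-forwards** (Bamler 2023, §2.5, proof of the
Lemma (`𝕄_r(V, b)` is closed): *"we may … find isometric embeddings `φᵢ : Xᵢ → Z`,
`i = 1, 2, …, ∞`, into a complete and separable metric space `(Z, d_Z)` such that
`(φᵢ)_* μᵢ → (φ_∞)_* μ_∞` in `W₁`"*).
[cite: Bamler2023, §2.5, proof of the Lemma (𝕄_r(V, b) is closed)] -/
theorem exists_common_polish_of_tendsto_gromovW1 {X : ℕ → Type u} [∀ i, MetricSpace (X i)]
    [∀ i, MeasurableSpace (X i)] [∀ i, BorelSpace (X i)] [∀ i, SecondCountableTopology (X i)]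
    [∀ i, CompleteSpace (X i)] (μ : ∀ i, Measure (X i)) [∀ i, IsProbabilityMeasure (μ i)]
    {X' : Type u} [MetricSpace X'] [MeasurableSpace X'] [BorelSpace X'] [SecondCountableTopology X']
    [CompleteSpace X'] (μ' : Measure X') [IsProbabilityMeasure μ']
    (hlim : Tendsto (fun i ↦ gromovW1 (μ i) μ') atTop (𝓝 0)) :
    ∃ (S : Type u) (_ : MetricSpace S) (_ : MeasurableSpace S) (_ : BorelSpace S)
      (_ : SecondCountableTopology S) (_ : CompleteSpace S) (e : ∀ i, X i → S) (e' : X' → S),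
      (∀ i, Isometry (e i)) ∧ Isometry e' ∧
      Tendsto (fun i ↦ wassersteinW1 ((μ i).map (e i)) (μ'.map e')) atTop (𝓝 0) := by
  haveI : Nonempty X' := nonempty_of_isProbabilityMeasure' μ'
  -- Step 1: embeddings almost realising `d_{GW₁}(Xᵢ, X')`
  have hex : ∀ i, ∃ (Z : Type u) (_ : MetricSpace Z) (φ : X i → Z) (ψ : X' → Z),
      Isometry φ ∧ Isometry ψ ∧ @wassersteinW1 Z _ (borel Z)
        (@Measure.map (X i) Z _ (borel Z) φ (μ i)) (@Measure.map X' Z _ (borel Z) ψ μ') ≤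
          gromovW1 (μ i) μ' + (i : ℝ≥0∞)⁻¹ :=
    fun i ↦ exists_embeddings_wassersteinW1_le_add (μ i) μ' (ENNReal.inv_pos.2 (ENNReal.natCast_ne_top i))
  choose Z instZ φ ψ hφ hψ hW using hex
  letI : ∀ k, MetricSpace (Z k) := instZ
  letI : ∀ k, MeasurableSpace (Z k) := fun k ↦ borel (Z k)
  haveI : ∀ k, BorelSpace (Z k) := fun k ↦ ⟨rfl⟩
  -- Step 2: glue along the copies of `X'`
  obtain ⟨W, instW, g, hg, hcomm⟩ :=
    exists_isometry_seq_comm (X := fun _ ↦ X') (Z := Z) (φm := ψ) (φp := fun k ↦ ψ k) hψ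
      (fun k ↦ hψ k)
  letI := instW
  letI : MeasurableSpace W := borel W
  haveI : BorelSpace W := ⟨rfl⟩
  -- all copies of `X'` coincide
  have hcopies : ∀ k, g k ∘ ψ k = g 0 ∘ ψ 0 := by
    intro k
    induction k with
    | zero => rfl
    | succ k ih => rw [← hcomm k, ih]
  have he : ∀ k, Isometry (g k ∘ φ k) := fun k ↦ (hg k).comp (hφ k)
  have he' : Isometry (g 0 ∘ ψ 0) := (hg 0).comp (hψ 0)
  have hW₁ : ∀ k, wassersteinW1 ((μ k).map (g k ∘ φ k)) (μ'.map (g 0 ∘ ψ 0)) ≤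
      gromovW1 (μ k) μ' + (k : ℝ≥0∞)⁻¹ := by
    intro k
    rw [← hcopies k, ← Measure.map_map (hg k).continuous.measurable (hφ k).continuous.measurable,
      ← Measure.map_map (hg k).continuous.measurable (hψ k).continuous.measurable]
    exact (wassersteinW1_map_le_of_edist_le (hg k).continuous.measurable
      (fun a b ↦ ((hg k).edist_eq a b).le) _ _).trans (hW k)
  -- Step 3: completion and the closed separable subspace
  let Wc := UniformSpace.Completion W
  letI : MeasurableSpace Wc := borel Wc
  haveI : BorelSpace Wc := ⟨rfl⟩
  have hι : Isometry ((↑) : W → Wc) := UniformSpace.Completion.coe_isometry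
  have hec : ∀ k, Isometry (((↑) : W → Wc) ∘ (g k ∘ φ k)) := fun k ↦ hι.comp (he k)
  have hec' : Isometry (((↑) : W → Wc) ∘ (g 0 ∘ ψ 0)) := hι.comp he'
  set S : Set Wc := closure (range (((↑) : W → Wc) ∘ (g 0 ∘ ψ 0)) ∪
    ⋃ k, range (((↑) : W → Wc) ∘ (g k ∘ φ k))) with hS_def
  haveI : CompleteSpace S := isClosed_closure.isComplete.completeSpace_coe
  have hSsep : IsSeparable S :=
    ((isSeparable_range hec'.continuous).union
      (IsSeparable.iUnion fun k ↦ isSeparable_range (hec k).continuous)).closure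
  haveI : SeparableSpace S := hSsep.separableSpace
  haveI : SecondCountableTopology S := UniformSpace.secondCountable_of_separable S
  set es : ∀ k, X k → S := fun k x ↦
    ⟨(((↑) : W → Wc) ∘ (g k ∘ φ k)) x,
      subset_closure (Or.inr (mem_iUnion.2 ⟨k, mem_range_self x⟩))⟩ with hes_def
  set es' : X' → S := fun x ↦
    ⟨(((↑) : W → Wc) ∘ (g 0 ∘ ψ 0)) x, subset_closure (Or.inl (mem_range_self x))⟩ with hes'_def
  have hes : ∀ k, Isometry (es k) := fun k ↦ Isometry.of_dist_eq fun a b ↦ (hec k).dist_eq a b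
  have hes' : Isometry es' := Isometry.of_dist_eq fun a b ↦ hec'.dist_eq a b
  have hval : Isometry ((↑) : S → Wc) := isometry_subtype_coe
  haveI : ∀ k, IsProbabilityMeasure ((μ k).map (es k)) := fun k ↦
    Measure.isProbabilityMeasure_map (hes k).continuous.measurable.aemeasurable
  haveI : IsProbabilityMeasure (μ'.map es') :=
    Measure.isProbabilityMeasure_map hes'.continuous.measurable.aemeasurable
  have hbound : ∀ k, wassersteinW1 ((μ k).map (es k)) (μ'.map es') ≤
      gromovW1 (μ k) μ' + (k : ℝ≥0∞)⁻¹ := by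
    intro k
    refine (wassersteinW1_le_wassersteinW1_map_isometry hval _ _).trans ?_
    have h1 : ((μ k).map (es k)).map ((↑) : S → Wc) =
        ((μ k).map (g k ∘ φ k)).map ((↑) : W → Wc) := by
      rw [Measure.map_map hval.continuous.measurable (hes k).continuous.measurable,
        Measure.map_map hι.continuous.measurable (he k).continuous.measurable]
      rfl
    have h2 : (μ'.map es').map ((↑) : S → Wc) = (μ'.map (g 0 ∘ ψ 0)).map ((↑) : W → Wc) := by
      rw [Measure.map_map hval.continuous.measurable hes'.continuous.measurable,
        Measure.map_map hι.continuous.measurable he'.continuous.measurable]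
      rfl
    rw [h1, h2]
    exact (wassersteinW1_map_le_of_edist_le hι.continuous.measurable
      (fun a b ↦ (hι.edist_eq a b).le) _ _).trans (hW₁ k)
  refine ⟨S, inferInstance, inferInstance, inferInstance, inferInstance, inferInstance, es, es',
    hes, hes', ?_⟩
  have h0 : Tendsto (fun k : ℕ ↦ gromovW1 (μ k) μ' + (k : ℝ≥0∞)⁻¹) atTop (𝓝 0) := by
    have h := hlim.add ENNReal.tendsto_inv_nat_nhds_zero
    rwa [add_zero] at h
  exact tendsto_of_tendsto_of_tendsto_of_le_of_le tendsto_const_nhds h0 (fun _ ↦ bot_le) hbound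

end Literature.Geometry.Riemannian

end
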